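/-
Origin: expansion seat `planner-pub-hodgecm-pv06-0`, handover (4) 2026-08-18T04:03:42Z (latest in place at cutoff) (`HOME/pub-hodgecm-pv06/lean/Pv06/PerL34/AnnihilationSm.lean`, md5 ad9f06ed, 73 lines);
landed by the gen-5 packager in gate run 21 as `HodgeCM/PerL34/AnnihilationSm.lean` (import ^import Pv[0-9]+\.PerL34\.→import HodgeCM.PerL34. ×1).
-/
/-
  pub-hodgecm — DAG node N23c, KERNEL SUPPLEMENT 2b (pv06): the `[SETUP D7]` fields `sm`, `sm_tendsto`,
  `sm_mem` of `HodgeCM.PerL34.Annihilation.AnnihilationDatum` (landed run 19) PRODUCED, with exactly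
  their types, over the frozen `IsolationCore` from: a measure on `G = U(W)(𝔸)` finite on compacts,
  strong continuity of `C.R`, and an approximate identity (`ApproxIdentity.IsApproxIdentity`; it exists by
  `ApproxIdentity.exists_isApproxIdentity` on first-countable locally compact T₂ groups with a measure
  positive on opens).  The bound `‖C.R g‖ ≤ 1` is derived from the frozen AX9 `R_unitary`.
  Imports the landed `HodgeCM.PerL34.Annihilation` and `Pv06.PerL34.ApproxIdentity`
  (↦ `HodgeCM.PerL34.ApproxIdentity`).  Nothing posited.
-/
import Summits.HodgeConjecture.HodgeCM.PerL34.Annihilation_2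
import Summits.HodgeConjecture.HodgeCM.PerL34.ApproxIdentity

/-! PORT of `HodgeCM/PerL34/AnnihilationSm.lean` (HodgeCMPerL run 82) — verbatim mechanical port; provenance in the PORT header line. -/

open MeasureTheory Filter Topology
open scoped InnerProductSpace
open HodgeCM.Prior.Perl34File HodgeCM.Prior.Perl34File.Perl34

noncomputable section

namespace HodgeCM.PerL34.Annihilation

variable {H HG CG G SK SigIdx SigIdxG : Type*}
variable [NormedAddCommGroup H] [InnerProductSpace ℂ H] [CompleteSpace H]
variable [NormedAddCommGroup HG] [InnerProductSpace ℂ HG] [CompleteSpace HG]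
variable [NormedAddCommGroup CG] [NormedSpace ℂ CG]
variable [Group G] [TopologicalSpace G] [TopologicalSpace SK]

/-- AX9 (unitarity) gives `‖R g v‖ = ‖v‖`. -/
theorem norm_R_apply (C : IsolationCore H HG CG G SK SigIdx SigIdxG) (g : G) (v : H) :
    ‖C.R g v‖ = ‖v‖ := by
  rw [norm_eq_sqrt_re_inner (𝕜 := ℂ) (C.R g v), norm_eq_sqrt_re_inner (𝕜 := ℂ) v, C.R_unitary]

/-- hence `‖R g‖ ≤ 1`. -/
theorem opNorm_R_le_one (C : IsolationCore H HG CG G SK SigIdx SigIdxG) (g : G) : ‖C.R g‖ ≤ 1 :=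
  ContinuousLinearMap.opNorm_le_bound _ zero_le_one fun v => by rw [one_mul, norm_R_apply]

variable [MeasurableSpace G] [OpensMeasurableSpace G]

/-- **The D7 fields of `AnnihilationDatum`, kernel-produced.**  Given a measure `μ` on `G` finite on
compacts, strong continuity of `R` and an approximate identity `(f_n)`, the operators
`sm n := R(f_n) = ∫ f_n(g) R(g) dμ(g)` satisfy `sm_tendsto` (`R(f_n)v → v` for every `v`) and `sm_mem`
(every closed `R`-invariant subspace is preserved) — verbatim the field types of `AnnihilationDatum`. -/
theorem sm_fields_of_isApproxIdentity (C : IsolationCore H HG CG G SK SigIdx SigIdxG)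
    (μ : Measure G) [IsFiniteMeasureOnCompacts μ] (hRc : ∀ v : H, Continuous fun g => C.R g v)
    {f : ℕ → G → ℝ} (hf : ApproxIdentity.IsApproxIdentity μ f) :
    ∃ sm : ℕ → (H →L[ℂ] H),
      (∀ n v, sm n v = ∫ g, (f n g : ℂ) • C.R g v ∂μ) ∧
      (∀ v : H, Tendsto (fun n => sm n v) atTop (𝓝 v)) ∧
      (∀ (M : Submodule ℂ H), IsClosed (M : Set H) → C.Invariant M →
        ∀ (n : ℕ), ∀ v ∈ M, sm n v ∈ M) :=
  ⟨fun n => ApproxIdentity.smOp μ C.R hRc 1 (opNorm_R_le_one C) (f n) (hf.cont n) (hf.cpt n),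
    fun _ _ => rfl,
    fun v => ApproxIdentity.smOp_tendsto μ C.R hRc 1 (opNorm_R_le_one C) hf v,
    fun M hM hinv n _ hv =>
      ApproxIdentity.smOp_mem_of_invariant μ C.R hRc 1 (opNorm_R_le_one C) (f n) (hf.cont n)
        (hf.cpt n) M hM hinv hv⟩

/-- Existence form: on a first-countable locally compact T₂ group with a measure finite on compacts and
positive on opens, and `R` strongly continuous, operators with the three D7 properties exist. -/
theorem exists_sm_fields [LocallyCompactSpace G] [T2Space G] [FirstCountableTopology G] (C : IsolationCore H HG CG G SK SigIdx SigIdxG)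
    (μ : Measure G) [IsFiniteMeasureOnCompacts μ] [μ.IsOpenPosMeasure]
    (hRc : ∀ v : H, Continuous fun g => C.R g v) :
    ∃ sm : ℕ → (H →L[ℂ] H),
      (∀ v : H, Tendsto (fun n => sm n v) atTop (𝓝 v)) ∧
      (∀ (M : Submodule ℂ H), IsClosed (M : Set H) → C.Invariant M →
        ∀ (n : ℕ), ∀ v ∈ M, sm n v ∈ M) := by
  obtain ⟨f, hf⟩ := ApproxIdentity.exists_isApproxIdentity μ
  obtain ⟨sm, -, h1, h2⟩ := sm_fields_of_isApproxIdentity C μ hRc hf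
  exact ⟨sm, h1, h2⟩

end HodgeCM.PerL34.Annihilation

end
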